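import Summits.CriticalPhenomena.CardyFormulaZ2.Theorems.HalfPlaneMarkDensityLaw.Negative.CardyContent
import Mathlib.MeasureTheory.Integral.Lebesgue.DominatedConvergence

/-!
# Line `Sketch`, converse direction — analysis (crux `HalfPlaneMarkDensityLaw`, stmt-CriticalPhenomena-5661):
# the crux implies the collinear half-plane Cardy law C⁺, given domination and a short-arc bound

The `limsup` half complementing the disprover's `liminf_crossing_ge_cardy` (`Negative.CardyContent`,
Fatou): with `G_n(t) = P[A_n ↔ [⌊cn⌋,⌊tn⌋]×{0}]`, `Φ(t) = F(η(a,b,c,t))`,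

* `measure_crossing_window` — exact window telescoping in `ℝ≥0∞`;
* `sum_window_le_lintegral` — the window sum `Σ_{⌊xn⌋<k≤⌊yn⌋} P[E(k)]` is at most
  `∫⁻_{(x,y+δ)} stepDensity n` once `1/n < δ`;
* `limsup_window_le` — REVERSE FATOU (`limsup_lintegral_le`) under a DOMINATION hypothesis
  `stepDensity n ≤ D` on `(x, ∞)` (supplied by the two-arm point bound in the companion percolation file)
  and the crux (pointwise limit `density`): `limsup_n Σ ≤ Φ(y+δ) − Φ(x)`;
* `stub_lawGivesCDF` (registered as a stub of the crux item) — with in addition a SHORT-ARC hypothesis `G_n(x) ≤ g(x)` eventually, `g → 0`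
  as `x ↓ c`: `G_n(y) → Φ(y)`, i.e. the CDF form of half-plane Cardy at `(a,b,c,y)`.
Both hypotheses are discharged unconditionally in `ConversePart1` from the line's STUB A and the tree's
RSW annulus decay, so the line yields `HalfPlaneMarkDensityLaw → C⁺` as well as `C⁺ → HalfPlaneMarkDensityLaw`.
-/

noncomputable section

namespace Summit.CriticalPhenomena.CardyFormulaZ2.Cruxes.HalfPlaneMarkDensityLaw.SketchLine

open Literature.Probability.Percolation Literature.Probability.LatticeModels
open Literature.Probability.RandomPlanarGeometry
open MeasureTheory Filter Set
open scoped Topology ENNReal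
open Summit.CriticalPhenomena.CardyFormulaZ2.Theses.CardyBoundaryCoulombGas (HalfPlaneMarkDensityLaw)
open Summit.CriticalPhenomena.CardyFormulaZ2.Theorems.HalfPlaneMarkDensityLaw.Negative

namespace Converse

/-- Cardy's function `F` (the `RandomPlanarGeometry` copy). -/
local notation "𝔽" => Literature.Probability.RandomPlanarGeometry.cardyFunction

/-! ### Window telescoping in `ℝ≥0∞` and the Riemann lower bound -/

/-- Exact window telescoping: `μ[A ↔ B_{k₁+m}] = μ[A ↔ B_{k₁}] + Σ_{i<m} μ[E(k₁+1+i)]` (`k₀ ≤ k₁+1`). [folklore] -/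
theorem measure_crossing_window (S A : Set (Site 2)) {k₀ k₁ : ℤ} (hk : k₀ ≤ k₁ + 1) (m : ℕ) :
    μ (openCrossing S A (rowIcc k₀ (k₁ + m))) =
      μ (openCrossing S A (rowIcc k₀ k₁)) + ∑ i ∈ Finset.range m, μ (firstHit S A k₀ (k₁ + 1 + i)) := by
  induction m with
  | zero => simp
  | succ m ih =>
    have hk' : k₀ ≤ k₁ + 1 + m := by omega
    rw [Finset.sum_range_succ, ← add_assoc, ← ih,
      show k₁ + ((m + 1 : ℕ) : ℤ) = k₁ + 1 + m by push_cast; ring,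
      openCrossing_rowIcc_succ S A hk', show k₁ + 1 + (m : ℤ) - 1 = k₁ + m by ring,
      measure_union (by
        have h := disjoint_openCrossing_firstHit S A k₀ (k₁ + 1 + m)
        rwa [show k₁ + 1 + (m : ℤ) - 1 = k₁ + m by ring] at h) (measurableSet_firstHit S A _ _)]

/-- **Riemann lower bound**: for `x ≤ y` and `1/n < δ`, the window sum of `μ[E(k)]`, `⌊xn⌋ < k ≤ ⌊yn⌋`,
is at most `∫⁻_{(x, y+δ)} stepDensity n` (each term is the integral over its cell, the cells lie in
`(x, y + 1/n]`). [folklore] -/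
theorem sum_window_le_lintegral (a b c : ℝ) {x y δ : ℝ} (hxy : x ≤ y) {n : ℕ} (hn : 0 < n)
    (hδ : 1 / (n : ℝ) < δ) :
    ∑ i ∈ Finset.range (⌊y * n⌋ - ⌊x * n⌋).toNat,
        μ (firstHit halfPlane (arcA a b n) ⌊c * n⌋ (⌊x * n⌋ + 1 + i)) ≤
      ∫⁻ t in Ioo x (y + δ), stepDensity a b c n t := by
  have hn' : (0 : ℝ) < n := by exact_mod_cast hn
  set M : ℕ := (⌊y * n⌋ - ⌊x * n⌋).toNat with hM
  have hMint : ((M : ℕ) : ℤ) = ⌊y * n⌋ - ⌊x * n⌋ :=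
    Int.toNat_of_nonneg (sub_nonneg.2 (Int.floor_le_floor (mul_le_mul_of_nonneg_right hxy hn'.le)))
  set E : ℕ → Set (BondConfig (Site 2)) := fun i ↦ firstHit halfPlane (arcA a b n) ⌊c * n⌋ (⌊x * n⌋ + 1 + i)
  set cell : ℕ → Set ℝ := fun i ↦ {t : ℝ | ⌊t * n⌋ = ⌊x * n⌋ + 1 + i} with hcell
  set g : ℝ → ℝ≥0∞ := fun t ↦ ∑ i ∈ Finset.range M, (cell i).indicator (fun _ ↦ (n : ℝ≥0∞) * μ (E i)) t
    with hg
  -- `g ≤ stepDensity` everywhere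
  have hdom : ∀ t, g t ≤ stepDensity a b c n t := by
    intro t
    by_cases ht : ∃ i ∈ Finset.range M, t ∈ cell i
    · obtain ⟨i, hi, hti⟩ := ht
      have hval : stepDensity a b c n t = (n : ℝ≥0∞) * μ (E i) := by
        rw [stepDensity, markEvent_eq_firstHit]
        simp only [hcell, mem_setOf_eq] at hti
        rw [hti]
      have hg' : g t = (cell i).indicator (fun _ ↦ (n : ℝ≥0∞) * μ (E i)) t := by
        refine Finset.sum_eq_single_of_mem i hi fun j _ hji ↦ ?_
        refine indicator_of_notMem (fun htj ↦ hji ?_) _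
        simp only [hcell, mem_setOf_eq] at hti htj
        have : (⌊x * ↑n⌋ + 1 + (j : ℤ)) = ⌊x * ↑n⌋ + 1 + i := by rw [← htj, hti]
        exact_mod_cast (by omega : (j : ℤ) = i)
      rw [hg', hval, indicator_of_mem hti]
    · push Not at ht
      have : g t = 0 := Finset.sum_eq_zero fun i hi ↦ indicator_of_notMem (ht i hi) _
      rw [this]; exact bot_le
  -- the cells lie in `(x, y + δ)`
  have hsub : ∀ i ∈ Finset.range M, cell i ⊆ Ioo x (y + δ) := by
    intro i hi t ht
    rw [Finset.mem_range] at hi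
    simp only [hcell, mem_setOf_eq, Int.floor_eq_iff] at ht
    have hi' : (i : ℤ) + 1 ≤ M := by exact_mod_cast hi
    rw [hMint] at hi'
    constructor
    · -- `t ≥ (⌊xn⌋+1+i)/n > x`
      have h1 : ((⌊x * n⌋ + 1 + i : ℤ) : ℝ) ≤ t * n := ht.1
      have h2 : x * n < ⌊x * n⌋ + 1 := Int.lt_floor_add_one _
      push_cast at h1
      have h3 : (0 : ℝ) ≤ i := Nat.cast_nonneg i
      nlinarith
    · -- `t < (⌊xn⌋+2+i)/n ≤ (⌊yn⌋+1)/n ≤ y + 1/n < y + δ`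
      have h1 : t * n < (⌊x * n⌋ + 1 + i : ℤ) + 1 := ht.2
      have h2 : ((⌊y * n⌋ : ℤ) : ℝ) ≤ y * n := Int.floor_le _
      have h4 : ((⌊x * n⌋ + 1 + i : ℤ) : ℝ) + 1 ≤ (⌊y * n⌋ : ℝ) + 1 := by
        have : ⌊x * (n : ℝ)⌋ + 1 + (i : ℤ) ≤ ⌊y * n⌋ := by omega
        exact_mod_cast (by omega : ⌊x * (n : ℝ)⌋ + 1 + (i : ℤ) + 1 ≤ ⌊y * n⌋ + 1)
      have h5 : t * n < y * n + 1 := by linarith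
      have h6 : t < y + 1 / n := by
        rw [← sub_lt_iff_lt_add', lt_div_iff₀ hn']; nlinarith
      linarith
  calc ∑ i ∈ Finset.range M, μ (E i)
      = ∑ i ∈ Finset.range M, ∫⁻ t, (cell i).indicator (fun _ ↦ (n : ℝ≥0∞) * μ (E i)) t := by
        refine Finset.sum_congr rfl fun i _ ↦ ?_
        rw [lintegral_indicator_const (measurableSet_setOf_floor_mul_eq n _),
          volume_setOf_floor_mul_eq hn, mul_comm (n : ℝ≥0∞) (μ (E i)), mul_assoc,
          natCast_mul_ofReal_one_div hn, mul_one]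
    _ = ∫⁻ t, g t := by
        rw [hg, lintegral_finsetSum]
        exact fun i _ ↦ measurable_const.indicator (measurableSet_setOf_floor_mul_eq n _)
    _ = ∫⁻ t in Ioo x (y + δ), g t := by
        refine (setLIntegral_eq_of_support_subset fun t ht ↦ ?_).symm
        rw [Function.mem_support] at ht
        by_contra hnot
        exact ht (Finset.sum_eq_zero fun i hi ↦ indicator_of_notMem (fun h ↦ hnot (hsub i hi h)) _)
    _ ≤ ∫⁻ t in Ioo x (y + δ), stepDensity a b c n t := lintegral_mono fun t ↦ hdom t

/-! ### Reverse Fatou under domination -/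

/-- **Window limsup**: if the crux holds (pointwise limits on `(c,∞)`) and the step densities are
dominated by a constant on `(x, ∞)` from some `n₁` on, then for `c < x ≤ y`, `0 < δ`,
`limsup_n Σ_{⌊xn⌋<k≤⌊yn⌋} μ[E(k)] ≤ ofReal (Φ(y+δ) − Φ(x))`. [folklore] -/
theorem limsup_window_le (hlaw : HalfPlaneMarkDensityLaw) {a b c x y δ D : ℝ} (hab : a < b) (hbc : b < c)
    (hcx : c < x) (hxy : x ≤ y) (hδ : 0 < δ) {n₁ : ℕ}
    (hdom : ∀ n : ℕ, n₁ ≤ n → ∀ t : ℝ, x < t → stepDensity a b c n t ≤ ENNReal.ofReal D) :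
    limsup (fun n : ℕ ↦ ∑ i ∈ Finset.range (⌊y * n⌋ - ⌊x * n⌋).toNat,
        μ (firstHit halfPlane (arcA a b n) ⌊c * n⌋ (⌊x * n⌋ + 1 + i))) atTop ≤
      ENNReal.ofReal (𝔽 (crossRatio ![a, b, c, y + δ]) - 𝔽 (crossRatio ![a, b, c, x])) := by
  rw [halfPlaneMarkDensityLaw_iff] at hlaw
  set Sm : ℕ → ℝ≥0∞ := fun n ↦ ∑ i ∈ Finset.range (⌊y * n⌋ - ⌊x * n⌋).toNat,
    μ (firstHit halfPlane (arcA a b n) ⌊c * n⌋ (⌊x * n⌋ + 1 + i)) with hSm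
  set I : ℕ → ℝ≥0∞ := fun n ↦ ∫⁻ t in Ioo x (y + δ), stepDensity a b c n t with hI
  -- Step 1: `Sm ≤ I` eventually
  have h1 : ∀ᶠ n : ℕ in atTop, Sm n ≤ I n := by
    have hev : ∀ᶠ n : ℕ in atTop, 1 / (n : ℝ) < δ := by
      have := tendsto_one_div_atTop_nhds_zero_nat.eventually (gt_mem_nhds hδ)
      exact this
    filter_upwards [hev, eventually_gt_atTop 0] with n hn hn0
    exact sum_window_le_lintegral a b c hxy hn0 hn
  -- Step 2: reverse Fatou for the shifted sequence
  set ν : Measure ℝ := volume.restrict (Ioo x (y + δ)) with hν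
  have hfin : ∫⁻ _ in Ioo x (y + δ), ENNReal.ofReal D ≠ ∞ := by
    rw [setLIntegral_const, Real.volume_Ioo]
    exact ENNReal.mul_ne_top ENNReal.ofReal_ne_top ENNReal.ofReal_ne_top
  have hbound : ∀ n : ℕ, (fun t ↦ stepDensity a b c (n + n₁) t) ≤ᵐ[ν] fun _ ↦ ENNReal.ofReal D := by
    intro n
    rw [hν, EventuallyLE, ae_restrict_iff' measurableSet_Ioo]
    exact ae_of_all _ fun t ht ↦ hdom (n + n₁) (by omega) t ht.1
  have hF := limsup_lintegral_le (μ := ν) (fun _ ↦ ENNReal.ofReal D)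
    (fun n ↦ measurable_stepDensity a b c (n + n₁)) hbound hfin
  -- pointwise limsup = density on `(x, y+δ)`
  have hpt : ∀ t ∈ Ioo x (y + δ), limsup (fun n : ℕ ↦ stepDensity a b c (n + n₁) t) atTop =
      ENNReal.ofReal (density a b c t) := by
    intro t ht
    have hlim := tendsto_stepDensity_of_lawAt (hlaw a b c t hab hbc (hcx.trans ht.1))
    exact ((hlim.comp (tendsto_add_atTop_nat n₁))).limsup_eq
  have hRHS : ∫⁻ t in Ioo x (y + δ), limsup (fun n : ℕ ↦ stepDensity a b c (n + n₁) t) atTop =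
      ENNReal.ofReal (𝔽 (crossRatio ![a, b, c, y + δ]) - 𝔽 (crossRatio ![a, b, c, x])) := by
    rw [setLIntegral_congr_fun measurableSet_Ioo hpt]
    have hxy' : x < y + δ := by linarith
    -- FTC on `[x, y+δ]`
    have hcont : ContinuousOn (fun t : ℝ ↦ 𝔽 (crossRatio ![a, b, c, t])) (Icc x (y + δ)) :=
      (continuousOn_cardy_crossRatio hab hbc).mono (Icc_subset_Icc hcx.le le_rfl)
    have hderiv : ∀ t ∈ Ioo x (y + δ),
        HasDerivAt (fun t : ℝ ↦ 𝔽 (crossRatio ![a, b, c, t])) (density a b c t) t :=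
      fun t ht ↦ hasDerivAt_cardy_crossRatio hab hbc (hcx.trans ht.1)
    have hint : IntegrableOn (fun t ↦ density a b c t) (Ioc x (y + δ)) :=
      (integrableOn_density hab hbc).mono_set (Ioc_subset_Ioc hcx.le le_rfl)
    have hint' : IntervalIntegrable (fun t ↦ density a b c t) volume x (y + δ) := by
      rw [intervalIntegrable_iff_integrableOn_Ioc_of_le hxy'.le]; exact hint
    rw [← intervalIntegral.integral_eq_sub_of_hasDerivAt_of_le hxy'.le hcont hderiv hint',
      intervalIntegral.integral_of_le hxy'.le,
      ofReal_integral_eq_lintegral_ofReal hint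
        (ae_restrict_of_forall_mem measurableSet_Ioc fun t ht ↦ (density_pos hab hbc (hcx.trans ht.1)).le),
      setLIntegral_congr Ioo_ae_eq_Ioc]
  -- Step 3: combine
  calc limsup Sm atTop ≤ limsup I atTop := limsup_le_limsup h1
    _ = limsup (fun n ↦ I (n + n₁)) atTop := (limsup_nat_add I n₁).symm
    _ ≤ ∫⁻ t in Ioo x (y + δ), limsup (fun n : ℕ ↦ stepDensity a b c (n + n₁) t) atTop := hF
    _ = _ := hRHS

/-! ### Assembly: the crux, domination and a short-arc bound give the CDF -/

/-- `Φ(t) = F(η(a,b,c,t))` is nonnegative for `t ≥ c` (`F` increasing on `[0,1]`, `F(0) = 0`). [folklore] -/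
theorem cardy_crossRatio_nonneg {a b c t : ℝ} (hab : a < b) (hbc : b < c) (hct : c ≤ t) :
    0 ≤ 𝔽 (crossRatio ![a, b, c, t]) := by
  have hmem := crossRatio_four_mem_Icc hab hbc hct
  have h := (Literature.Probability.RandomPlanarGeometry.strictMonoOn_cardyFunction_holds).monotoneOn
    (left_mem_Icc.2 zero_le_one) hmem hmem.1
  rwa [Literature.Probability.RandomPlanarGeometry.cardyFunction_zero] at h

/-- `Φ` is continuous from the right at `c` with value `0`: `Φ(x) → 0` as `x ↓ c`. [folklore] -/
theorem tendsto_cardy_crossRatio_right (a b c : ℝ) (hab : a < b) (hbc : b < c) :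
    Tendsto (fun x : ℝ ↦ 𝔽 (crossRatio ![a, b, c, x])) (𝓝[>] c) (𝓝 0) := by
  have hcont := (continuousOn_cardy_crossRatio (x := c + 1) hab hbc).continuousWithinAt
    (left_mem_Icc.2 (by linarith))
  have h0 : 𝔽 (crossRatio ![a, b, c, c]) = 0 := by
    rw [crossRatio_four]; simp [Literature.Probability.RandomPlanarGeometry.cardyFunction_zero]
  rw [ContinuousWithinAt, h0] at hcont
  have hle : 𝓝[>] c ≤ 𝓝[Icc c (c + 1)] c := by
    rw [← nhdsWithin_Ioo_eq_nhdsGT (show c < c + 1 by linarith)]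
    exact nhdsWithin_mono _ fun t ht ↦ ⟨ht.1.le, ht.2.le⟩
  exact hcont.mono_left hle

/-- `Φ` is continuous from the right at every `y > c`. [folklore] -/
theorem tendsto_cardy_crossRatio_right' {a b c y : ℝ} (hab : a < b) (hbc : b < c) (hcy : c < y) :
    Tendsto (fun t : ℝ ↦ 𝔽 (crossRatio ![a, b, c, t])) (𝓝[>] y) (𝓝 (𝔽 (crossRatio ![a, b, c, y]))) := by
  have hcont := (continuousOn_cardy_crossRatio (x := y + 1) hab hbc).continuousWithinAt
    (⟨hcy.le, by linarith⟩ : y ∈ Icc c (y + 1))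
  have hle : 𝓝[>] y ≤ 𝓝[Icc c (y + 1)] y := by
    rw [← nhdsWithin_Ioo_eq_nhdsGT (show y < y + 1 by linarith)]
    exact nhdsWithin_mono _ fun t ht ↦ ⟨hcy.le.trans ht.1.le, ht.2.le⟩
  exact hcont.mono_left hle

/-- **The crux + domination + short-arc bound ⇒ the collinear half-plane Cardy CDF at `(a,b,c,y)`.**
Hypotheses: `hdom` — for every `x > c` the step densities are eventually dominated by a constant on
`(x,∞)` (two-arm point bound); `hshort` — a bound `g(x)` on `P[A_n ↔ [⌊cn⌋,⌊xn⌋]×{0}]`, eventually in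
`n`, with `g(x) → 0` as `x ↓ c` (RSW annulus decay). [folklore] -/
theorem stub_lawGivesCDF :
    HalfPlaneMarkDensityLaw → ∀ a b c y : ℝ, a < b → b < c → c < y →
      (∀ x : ℝ, c < x → ∃ D : ℝ, ∃ n₁ : ℕ, ∀ n : ℕ, n₁ ≤ n → ∀ t : ℝ, x < t →
        stepDensity a b c n t ≤ ENNReal.ofReal D) →
      ∀ g : ℝ → ℝ, Tendsto g (𝓝[>] c) (𝓝 0) →
      (∀ᶠ x : ℝ in 𝓝[>] c, ∀ᶠ n : ℕ in atTop,
        μ.real (openCrossing halfPlane (arcA a b n) (rowIcc ⌊c * n⌋ ⌊x * n⌋)) ≤ g x) →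
      Tendsto (fun n : ℕ ↦ μ.real (openCrossing halfPlane (arcA a b n) (rowIcc ⌊c * n⌋ ⌊y * n⌋))) atTop
        (𝓝 (Literature.Probability.RandomPlanarGeometry.cardyFunction
          (Literature.Probability.RandomPlanarGeometry.crossRatio ![a, b, c, y]))) := by
  intro hlaw a b c y hab hbc hcy hdom g hg hshort
  set Φ : ℝ → ℝ := fun t ↦ 𝔽 (crossRatio ![a, b, c, t]) with hΦ
  rw [tendsto_order]
  refine ⟨fun L hL ↦ ?_, fun U hU ↦ ?_⟩
  · -- liminf half: Fatou (`Negative.CardyContent.eventually_crossing_gt`)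
    have h := eventually_crossing_gt hlaw hab hbc hcy (ε := Φ y - L) (by simp only [hΦ] at hL ⊢; linarith)
    filter_upwards [h] with n hn
    simp only [hΦ] at hn ⊢
    linarith
  · -- limsup half
    have hε : 0 < U - Φ y := by simp only [hΦ] at hU ⊢; linarith
    set ε := U - Φ y with hεdef
    -- choose `x` near `c`
    have hx1 : ∀ᶠ x : ℝ in 𝓝[>] c, g x < ε / 3 := hg.eventually (gt_mem_nhds (by linarith))
    have hx2 : ∀ᶠ x : ℝ in 𝓝[>] c, x ∈ Ioo c y := Ioo_mem_nhdsGT hcy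
    obtain ⟨x, hgx, ⟨hcx, hxy⟩, hshortx⟩ := (hx1.and (hx2.and hshort)).exists
    -- choose `δ` with `Φ(y+δ) < Φ(y) + ε/3`
    have hd1 : ∀ᶠ t : ℝ in 𝓝[>] y, Φ t < Φ y + ε / 3 :=
      (tendsto_cardy_crossRatio_right' hab hbc hcy).eventually (gt_mem_nhds (by linarith))
    have hd2 : ∀ᶠ t : ℝ in 𝓝[>] y, t ∈ Ioo y (y + 1) := Ioo_mem_nhdsGT (by linarith)
    obtain ⟨t, hΦt, hty, -⟩ := (hd1.and hd2).exists
    set δ := t - y with hδ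
    have hδ0 : 0 < δ := by rw [hδ]; linarith [hty]
    have hyδ : y + δ = t := by rw [hδ]; ring
    -- the window limsup
    obtain ⟨D, n₁, hD⟩ := hdom x hcx
    have hlimsup := limsup_window_le hlaw hab hbc hcx hxy.le hδ0 hD
    rw [hyδ] at hlimsup
    have hΦx0 : 0 ≤ Φ x := cardy_crossRatio_nonneg hab hbc hcx.le
    have hΦy0 : 0 ≤ Φ y := cardy_crossRatio_nonneg hab hbc hcy.le
    have hlt : limsup (fun n : ℕ ↦ ∑ i ∈ Finset.range (⌊y * n⌋ - ⌊x * n⌋).toNat,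
        μ (firstHit halfPlane (arcA a b n) ⌊c * n⌋ (⌊x * n⌋ + 1 + i))) atTop <
        ENNReal.ofReal (Φ y + ε / 3) := by
      refine lt_of_le_of_lt hlimsup ((ENNReal.ofReal_lt_ofReal_iff (by linarith)).2 ?_)
      simp only [hΦ] at hΦt hΦx0 ⊢
      linarith
    have hwin := eventually_lt_of_limsup_lt hlt
    -- combine
    filter_upwards [hwin, hshortx] with n hn hsn
    have hk : ⌊c * (n : ℝ)⌋ ≤ ⌊x * (n : ℝ)⌋ + 1 := by
      have := Int.floor_le_floor (mul_le_mul_of_nonneg_right hcx.le (Nat.cast_nonneg n)); omega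
    have hMint : (((⌊y * n⌋ - ⌊x * n⌋).toNat : ℕ) : ℤ) = ⌊y * n⌋ - ⌊x * n⌋ :=
      Int.toNat_of_nonneg (sub_nonneg.2 (Int.floor_le_floor
        (mul_le_mul_of_nonneg_right hxy.le (Nat.cast_nonneg n))))
    have hwindow := measure_crossing_window halfPlane (arcA a b n) hk (⌊y * n⌋ - ⌊x * n⌋).toNat
    rw [hMint, show ⌊x * (n : ℝ)⌋ + (⌊y * n⌋ - ⌊x * n⌋) = ⌊y * n⌋ by ring] at hwindow
    -- in `ℝ≥0∞`: μ(y-event) < ofReal (g x) + ofReal (Φ y + ε/3) ≤ ofReal U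
    have hxev : μ (openCrossing halfPlane (arcA a b n) (rowIcc ⌊c * n⌋ ⌊x * n⌋)) ≤ ENNReal.ofReal (ε / 3) := by
      rw [← ENNReal.ofReal_toReal (measure_ne_top μ _)]
      exact ENNReal.ofReal_le_ofReal (by rw [← measureReal_def]; linarith)
    have hyev : μ (openCrossing halfPlane (arcA a b n) (rowIcc ⌊c * n⌋ ⌊y * n⌋)) <
        ENNReal.ofReal (ε / 3) + ENNReal.ofReal (Φ y + ε / 3) := by
      rw [hwindow]
      exact ENNReal.add_lt_add_of_le_of_lt (measure_ne_top μ _) hxev hn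
    rw [← ENNReal.ofReal_add (by linarith) (by linarith)] at hyev
    have hfin : μ (openCrossing halfPlane (arcA a b n) (rowIcc ⌊c * n⌋ ⌊y * n⌋)) ≠ ∞ := measure_ne_top μ _
    have := (ENNReal.toReal_lt_toReal hfin ENNReal.ofReal_ne_top).2 hyev
    rw [ENNReal.toReal_ofReal (by linarith), ← measureReal_def] at this
    simp only [hΦ] at this ⊢
    linarith

end Converse

end Summit.CriticalPhenomena.CardyFormulaZ2.Cruxes.HalfPlaneMarkDensityLaw.SketchLine
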